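import Literature.Geometry.Lorentzian.StationaryBlackHoleUniquenessProofs
import Literature.Geometry.Lorentzian.CauchyHypersurfaceRetraction
import Literature.Geometry.Lorentzian.CausalityOpennessProofs
import HarnessLib

/-!
# Every Killing orbit through `⟨⟨M_ext⟩⟩` meets the hypersurface `S` of `I⁺`-regularity
# (Chruściel–Costa 2008, §4.2, proof of Thm. 4.5: `⟨⟨M_ext⟩⟩ = ⋃ₜ φₜ(S)`)

The structure theorem of Chruściel–Costa, Astérisque 321 (2008) = arXiv:0806.0016, Thm. 4.5 —
`⟨⟨M_ext⟩⟩ ≈ ℝ × S₀` with the stationary flow translating the `ℝ`-factor — begins (§4.2, display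
before Prop. 4.4): "Since `S` is achronal it partitions `⟨⟨M_ext⟩⟩` as
`⟨⟨M_ext⟩⟩ = I⁺(S) ∪ S ∪ I⁻(S)` (disjoint union) … We claim that every orbit of `K₀` intersects
`S`. For this, recall that for any `q` in `⟨⟨M_ext⟩⟩` there exist points `p_± ∈ M_ext` such that
`q ∈ I^∓(p_±)` … which shows that every orbit of `K₀` meets both the future and the past of `S`. By
continuity and (partition) every orbit meets `S` (perhaps more than once). Hence
`⟨⟨M_ext⟩⟩ = ⋃ₜ φₜ(S)`."  The tree has the "both the future and the past" step
(`IPlusRegularHypersurface.exists_apply_mem_chronologicalPast_and_Future`,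
`StationaryBlackHoleUniquenessProofs.lean`).  This file supplies the "by continuity" step and the
conclusion `⟨⟨M_ext⟩⟩ = ⋃ₜ φₜ(S)`, taking the covering half of the partition,
`⟨⟨M_ext⟩⟩ ⊆ I⁺(S) ∪ S ∪ I⁻(S)`, as an explicit hypothesis `hpart` (its printed justification — global
hyperbolicity of `⟨⟨M_ext⟩⟩` makes `(İ^±(S) ∖ S) ∩ ⟨⟨M_ext⟩⟩` null hypersurfaces ruled by generators
ending on `edge(S) ∩ ⟨⟨M_ext⟩⟩ = ∅` — is not formalised here); the disjointness half is automatic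
from the achronality of `S` (`IsAchronal.not_mem_chronologicalPast_of_mem_chronologicalFuture`):

* `LorentzianMetric.IsAchronal.inter_nonempty_of_isPreconnected` — **continuity step, abstractly**:
  a preconnected set lying in `I⁺(S) ∪ S ∪ I⁻(S)` and meeting both `I⁺(S)` and `I⁻(S)`, `S`
  achronal, meets `S` (`I^±(S)` are open and, by achronality, disjoint);
* `StationaryAFBlackHole.IPlusRegularHypersurface.exists_apply_mem_carrierSet` — **every orbit of
  the stationary Killing field through a point of `⟨⟨M_ext⟩⟩` meets `S`** (given `hpart`);
* `StationaryAFBlackHole.IPlusRegularHypersurface.stationaryOrbit_carrierSet_eq_doc` —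
  **`⋃ₜ φₜ(S) = ⟨⟨M_ext⟩⟩`** (given `hpart`): Chruściel–Costa's (4.13).

Everything is proved; no definitions, no named facts.

## References

* P. T. Chruściel, J. L. Costa, *On uniqueness of stationary vacuum black holes*, Astérisque 321
  (2008) 195–265, arXiv:0806.0016, §4.2, proof of Thm. 4.5 (key `ChruscielCosta2008`).
* B. O'Neill, *Semi-Riemannian geometry*, Academic Press 1983, Ch. 14, Lemma 14.3 (openness of
  `I^±`), p. 413 (achronal sets) (key `ONeillSemiRiemannian1983`).
-/

noncomputable section

open Bundle Set Function Filter Manifold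
open scoped Manifold ContDiff Topology

namespace Literature.Geometry.Lorentzian

universe u

/-! ### The continuity step, abstractly -/

namespace LorentzianMetric

variable {E : Type*} [NormedAddCommGroup E] [NormedSpace ℝ E] {H : Type*} [TopologicalSpace H]
  {I : ModelWithCorners ℝ E H} {M : Type*} [TopologicalSpace M] [ChartedSpace H M]
  [IsManifold I ∞ M] {n : ℕ∞ω} {g : LorentzianMetric I n M} {τ : TimeOrientation g}

/-- **A connected set meeting both the future and the past of an achronal set `S`, and lying in
`I⁺(S) ∪ S ∪ I⁻(S)`, meets `S`.**  On a manifold without boundary `I⁺(S)` and `I⁻(S)` are open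
(O'Neill's Lemma 14.3) and, `S` being achronal, disjoint (`s₁ ≪ q ≪ s₂` would give `s₁ ≪ s₂`); a
preconnected `A ⊆ I⁺(S) ∪ I⁻(S)` meeting both is impossible, so `A` meets `S`.  This is the
"by continuity and (partition) every orbit meets `S`" of Chruściel–Costa 2008, §4.2 (proof of
Thm. 4.5), for an arbitrary connected set in place of an orbit. [cite: ChruscielCosta2008, §4.2 (proof of Thm. 4.5)] -/
theorem IsAchronal.inter_nonempty_of_isPreconnected [BoundarylessManifold I M] {S A : Set M}
    (hS : g.IsAchronal τ S) (hA : IsPreconnected A)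
    (hsub : A ⊆ g.chronologicalFuture τ S ∪ S ∪ g.chronologicalPast τ S)
    (hfut : (A ∩ g.chronologicalFuture τ S).Nonempty)
    (hpast : (A ∩ g.chronologicalPast τ S).Nonempty) : (A ∩ S).Nonempty := by
  by_contra hAS
  rw [Set.not_nonempty_iff_eq_empty] at hAS
  have hsub' : A ⊆ g.chronologicalFuture τ S ∪ g.chronologicalPast τ S := by
    intro a ha
    rcases hsub ha with (h | h) | h
    · exact Or.inl h
    · exact (Set.eq_empty_iff_forall_notMem.1 hAS a ⟨ha, h⟩).elim
    · exact Or.inr h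
  have hdisj : Disjoint (g.chronologicalFuture τ S) (g.chronologicalPast τ S) :=
    Set.disjoint_left.2 fun _ hy ↦ hS.not_mem_chronologicalPast_of_mem_chronologicalFuture hy
  rcases hA.subset_or_subset (isOpen_chronologicalFuture_of_boundaryless g τ S)
      (isOpen_chronologicalPast_of_boundaryless g τ S) hdisj hsub' with h | h
  · obtain ⟨a, haA, haP⟩ := hpast
    exact Set.disjoint_left.1 hdisj (h haA) haP
  · obtain ⟨a, haA, haF⟩ := hfut
    exact Set.disjoint_left.1 hdisj haF (h haA)

/-- **Curve form**: a continuous curve `γ : ℝ → M` lying in `I⁺(S) ∪ S ∪ I⁻(S)` and meeting both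
`I⁺(S)` and `I⁻(S)`, `S` achronal, meets `S` (the range of `γ` is connected). Chruściel–Costa
2008, §4.2 (proof of Thm. 4.5). [cite: ChruscielCosta2008, §4.2 (proof of Thm. 4.5)] -/
theorem IsAchronal.exists_apply_mem_of_continuous [BoundarylessManifold I M] {S : Set M}
    (hS : g.IsAchronal τ S) {γ : ℝ → M} (hγ : Continuous γ)
    (hsub : ∀ t, γ t ∈ g.chronologicalFuture τ S ∪ S ∪ g.chronologicalPast τ S)
    (hfut : ∃ t, γ t ∈ g.chronologicalFuture τ S) (hpast : ∃ t, γ t ∈ g.chronologicalPast τ S) :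
    ∃ t, γ t ∈ S := by
  obtain ⟨tf, htf⟩ := hfut
  obtain ⟨tp, htp⟩ := hpast
  obtain ⟨_, ⟨t, rfl⟩, ht⟩ := hS.inter_nonempty_of_isPreconnected
    (isConnected_range hγ).isPreconnected (by rintro _ ⟨t, rfl⟩; exact hsub t)
    ⟨γ tf, Set.mem_range_self _, htf⟩ ⟨γ tp, Set.mem_range_self _, htp⟩
  exact ⟨t, ht⟩

end LorentzianMetric

/-! ### Orbits through the domain of outer communications meet `S` -/

namespace StationaryAFBlackHole

namespace IPlusRegularHypersurface

variable {𝓑 : StationaryAFBlackHole.{u}} [𝓑.metric.HasLeviCivita] (𝒮 : 𝓑.IPlusRegularHypersurface)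

/-- **Every orbit of the stationary Killing field through `⟨⟨M_ext⟩⟩` meets the hypersurface `S`
of Definition 1.1**, granted the covering half `⟨⟨M_ext⟩⟩ ⊆ I⁺(S) ∪ S ∪ I⁻(S)` of Chruściel–Costa's
partition (hypothesis `hpart`): the orbit through `q ∈ ⟨⟨M_ext⟩⟩` is a connected subset of
`⟨⟨M_ext⟩⟩` (`mem_doc_of_isMIntegralCurve`) meeting `I⁻(S)` and `I⁺(S)`
(`exists_apply_mem_chronologicalPast_and_Future`), and `S` is achronal. Chruściel–Costa 2008,
§4.2, proof of Thm. 4.5 ("every orbit meets `S` (perhaps more than once)"). [cite: ChruscielCosta2008, §4.2 (proof of Thm. 4.5)] -/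
theorem exists_apply_mem_carrierSet
    (hpart : 𝓑.doc ⊆ 𝓑.metric.chronologicalFuture 𝓑.timeOrientation 𝒮.carrierSet ∪ 𝒮.carrierSet ∪
      𝓑.metric.chronologicalPast 𝓑.timeOrientation 𝒮.carrierSet)
    {q : 𝓑.carrier} (hq : q ∈ 𝓑.doc) {γ : ℝ → 𝓑.carrier} (hγ : IsMIntegralCurve γ 𝓑.killing)
    (hγ0 : γ 0 = q) : ∃ t : ℝ, γ t ∈ 𝒮.carrierSet := by
  obtain ⟨hP, hF⟩ := 𝒮.exists_apply_mem_chronologicalPast_and_Future hq hγ hγ0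
  have hdoc : ∀ t, γ t ∈ 𝓑.doc := mem_doc_of_isMIntegralCurve hγ (hγ0 ▸ hq)
  exact 𝒮.isAchronal.exists_apply_mem_of_continuous hγ.continuous (fun t ↦ hpart (hdoc t)) hF hP

/-- **`⋃ₜ φₜ(S) = ⟨⟨M_ext⟩⟩`** (Chruściel–Costa's (4.13)), granted `⟨⟨M_ext⟩⟩ ⊆ I⁺(S) ∪ S ∪ I⁻(S)`:
the orbit of `S ⊆ ⟨⟨M_ext⟩⟩` stays in the flow-invariant `⟨⟨M_ext⟩⟩`, and conversely the orbit through
any `q ∈ ⟨⟨M_ext⟩⟩` (the Killing field is complete) passes through `S`, so `q` lies on the orbit of a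
point of `S`. Chruściel–Costa 2008, §4.2, proof of Thm. 4.5, (4.13). [cite: ChruscielCosta2008, §4.2 (4.13)] -/
theorem stationaryOrbit_carrierSet_eq_doc
    (hpart : 𝓑.doc ⊆ 𝓑.metric.chronologicalFuture 𝓑.timeOrientation 𝒮.carrierSet ∪ 𝒮.carrierSet ∪
      𝓑.metric.chronologicalPast 𝓑.timeOrientation 𝒮.carrierSet) :
    stationaryOrbit 𝓑.killing 𝒮.carrierSet = 𝓑.doc := by
  refine Set.Subset.antisymm ?_ fun q hq ↦ ?_
  · rintro _ ⟨γ, hγ, h0, t, rfl⟩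
    exact mem_doc_of_isMIntegralCurve hγ (𝒮.carrierSet_subset_doc h0) t
  · obtain ⟨γ, hγ, hγ0⟩ := 𝓑.isStationaryKilling.isCompleteVectorField q
    obtain ⟨t, ht⟩ := 𝒮.exists_apply_mem_carrierSet hpart hq hγ hγ0
    refine ⟨γ ∘ (· + t), hγ.comp_add t, by simpa using ht, -t, ?_⟩
    simp [hγ0]

/-- In particular, granted the partition, **`⟨⟨M_ext⟩⟩` lies in the orbit of `S`**: every point of
the d.o.c. is `φₜ(s)` for some `s ∈ S`, `t ∈ ℝ`. Chruściel–Costa 2008, §4.2, (4.13). [cite: ChruscielCosta2008, §4.2 (4.13)] -/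
theorem doc_subset_stationaryOrbit_carrierSet
    (hpart : 𝓑.doc ⊆ 𝓑.metric.chronologicalFuture 𝓑.timeOrientation 𝒮.carrierSet ∪ 𝒮.carrierSet ∪
      𝓑.metric.chronologicalPast 𝓑.timeOrientation 𝒮.carrierSet) :
    𝓑.doc ⊆ stationaryOrbit 𝓑.killing 𝒮.carrierSet :=
  (𝒮.stationaryOrbit_carrierSet_eq_doc hpart).symm.subset

end IPlusRegularHypersurface

end StationaryAFBlackHole

end Literature.Geometry.Lorentzian

end
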